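import Literature.NumberTheory.EllipticCurves.DeShalit1987.RayClassFieldPAdicReading
import Literature.NumberTheory.EllipticCurves.FormalGroupLubinTateLogarithmDegreeOnePadic
import Literature.NumberTheory.EllipticCurves.FormalLogExpBaseChangeProofs
import Literature.NumberTheory.EllipticCurves.X049IntegralModelReadings
import HarnessLib

/-!
# The formal CM action `T = [π₀]_Ê = exp_W(π₀·log_W)` of `X₀(49)` OVER THE `𝔓`-ADIC READING RING, with its complex and
# `𝔓`-adic readings (de Shalit II.1.10, II.4.9 (ii): «`Ê` projects to a Lubin–Tate group … `[ψ(𝔭)]_Ê ∈ 𝔉_{ψ(𝔭)}`» — brick B8a)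

Topic `NumberTheory/EllipticCurves` (theorems only; no definition, no named fact, no instance, no `sorry`).  Sequel of
`DeShalit1987/RayClassFieldPAdicReading` (the localization `𝒪_{F,(𝔓)} = readingRing E hE ⊂ K(𝔪)` with `ψ_𝔓 = readingHom : 𝒪_{F,(𝔓)} → 𝒪_E`).
The (e)-assembler of the measure lane of cell `bsd-print-cf2` (memo `Cruxes/TwoVariableMainConjAtSplitTwoQuad/ALPHA-ASSEMBLY-w4g15.md`
§3, brick B8) needs the power series `T = [π₀]_Ê` of the formal group of the `K`-model `W = [1,−1,0,−2,−1]` of `X₀(49)` (`K = ℚ(√−7)`,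
`π₀ = ψ_E(v)` the generator of `v ∣ 2` singled out by FRAME-7) as a series OVER THE DATA RING `A = readingRing E hE` of
`CMFormalActionNilIdealPointsChart.some_add_ptOfZ_evalPt₁_eq_of_cm_identities`, together with its two readings:
COMPLEX — `T^{φ} = exp_{W_ℂ}(φ(π₀)·log_{W_ℂ})` for any `φ : K(𝔪) → S` into a `ℚ`-algebra (the shape
`PowerSeries.subst (C α * W.formalLog) W.formalExp` of `CMFormalActionTaylorOfTransformationProofs`) — and `𝔓`-ADIC —
`T^{ψ_𝔓} = P′ := P.map (LTCoeff.of ∘ e⁻¹)` read in `𝒪_E`, `P ∈ ℤ₂⟦X⟧` the Lubin–Tate series of `X049FormalGroupLubinTateTwo.cm7Padic_exists_formalGroupLaw_eq_ltF`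
(`P ↦ exp_V(c·log_V)`, `c = e₂(π₀)`).  What is proved:

* §1 (generic lift) `readingFieldHom_algebraMap` (`e|_{K(𝔪)}` on `K` is `K → K_v → E`), `algebraMap_mem_readingRing_of_mem_integer`
  (a `v`-integral element of `K` lies in `𝒪_{F,(𝔓)}`), ★ `exists_powerSeries_readingRing_of_forall_mem_integer` — **a series over `K` whose
  image in `K_v⟦X⟧` has `𝒪_v`-coefficients lifts (uniquely) to `(readingRing E hE)⟦X⟧`**, with its readings
  `map_readingHom_eq_of_map_subtype_eq` (`ψ_𝔓`-reading = the `𝒪_v`-series read in `𝒪_E`) and `map_comp_subtype_eq_of_map_subtype_eq`;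
* §2 (the series) `map_cm7FormalMulBy` (`exp_W(π·log_W)` commutes with ring maps of `ℚ`-algebras for the integer model),
  ★ `cm7FormalMulBy_eq_map_of_padicDatum` (**over `K_v`: `exp_W(π₀·log_W) = P` read through `ℚ₂ ≃ K_v`** when `eK(π₀) = c`),
  `cm7FormalMulBy_eq_map_map_of_padicDatum` (`= (P.map e⁻¹).map (𝒪_v ⊂ K_v)`: `𝒪_v`-coefficients);
* §3 ★★ `exists_readingSeries_cm7FormalMulBy` — **`∃ T_R ∈ (readingRing E hE)⟦X⟧`, `T_R(0) = 0`, `T_R ↦ exp_{W_K}(π₀ log_{W_K})` in `K(𝔪)⟦X⟧`,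
  `T_R^{ψ_𝔓} = P′` read in `𝒪_E`, and `T_R^{g} = exp_{W_S}(g(π₀)·log_{W_S})` for every ring map `g : K(𝔪) → S` into a `ℚ`-algebra** — the
  `T` of brick B8 with both readings (the identities `hidX`/`hidY` over `readingRing` — B8b — descend along `g = ι̂ ∘ coe` by
  `CMFormalActionNilIdealPoints` §0 / `…PointsY` §0 once the complex data are lifted; not in this file);
* §4 (appended) ★ `exists_polynomial_readingRing_of_forall_mem_integer` — the same lift for POLYNOMIALS over `K` with `v`-integral
  coefficients (the certificate polynomials `P̂_R, Q̂_R`), with `polynomial_map_comp_subtype_eq_of_map_subtype_eq`,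
  `polynomial_map_readingHom_eq_of_map_subtype_eq`.

Cell `bsd-print-cf2`, width seat `bsd-line-cf2-p1-w7` g15; nothing here closes a crux; no summit statement is proved; BSD is not proved by any of this.

## References
* [deShalit1987] E. de Shalit, *Iwasawa theory of elliptic curves with complex multiplication* (1987), II §1.10 Lemma (p. 39: `Ê_𝔓` is
  Lubin–Tate for `ψ(𝔭)`), II §4.2 (p. 56), II §4.9 (ii) (p. 62–63: «This allows us to move from the complex domain to the p-adics»).
* [SilvermanAEC2009] J. H. Silverman, *The Arithmetic of Elliptic Curves*, 2nd ed. (2009), IV.4–IV.5 (`log`, `exp` over `ℤ[aᵢ] ⊗ ℚ`).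
* [FrohlichTaylor1990] A. Fröhlich, M. J. Taylor, *Algebraic Number Theory* (1991), Ch. III §1 (1.14)(a) (`K_v ≅ ℚ_p` at a place of degree one).
-/

noncomputable section

open scoped NumberField
open Field IsDedekindDomain ValuativeRel PowerSeries
open Literature.NumberTheory.GaloisRepresentations Literature.NumberTheory.GaloisRepresentations.IsNonarchimedeanLocalField
  Literature.NumberTheory.GaloisRepresentations.LubinTate Literature.NumberTheory.NumberFields

namespace Literature.NumberTheory.EllipticCurves

namespace DeShalit1987

variable {K : Type} [Field K] [NumberField K] {v : HeightOneSpectrum (𝓞 K)} {𝔪 : Ideal (𝓞 K)}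

attribute [local instance] ltNormUniformSpace ltNormIsUniformAddGroup rk1 nF nE fintypeResidueField

/-! ## §1. Lifting `v`-integral data of `K` into the reading ring -/

section Lift

variable (E : IntermediateField (v.adicCompletion K) (AlgebraicClosure (v.adicCompletion K)))
  [FiniteDimensional (v.adicCompletion K) E]
  (hE : ∀ y : AlgebraicClosure K, y ∈ rayClassField K 𝔪 → absClosureEmbedding K (v.adicCompletion K) y ∈ E)

omit [FiniteDimensional (v.adicCompletion K) E] in
/-- **`e|_{K(𝔪)}` on an element of `K` is `K → K_v → E`** (the chosen embedding `K̄ → K̄_v` is `K`-linear).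
[cite: NeukirchANT1999, Ch. II §8] -/
theorem readingFieldHom_algebraMap (t : K) :
    readingFieldHom E hE (algebraMap K (rayClassField K 𝔪) t) =
      algebraMap (v.adicCompletion K) E (algebraMap K (v.adicCompletion K) t) := by
  apply Subtype.ext
  rw [coe_readingFieldHom]
  have h1 : ((algebraMap K (rayClassField K 𝔪) t : rayClassField K 𝔪) : AlgebraicClosure K) = algebraMap K (AlgebraicClosure K) t :=
    (IsScalarTower.algebraMap_apply K (rayClassField K 𝔪) (AlgebraicClosure K) t).symm
  have h2 : ((algebraMap (v.adicCompletion K) E (algebraMap K (v.adicCompletion K) t) : E) : AlgebraicClosure (v.adicCompletion K)) =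
      algebraMap (v.adicCompletion K) (AlgebraicClosure (v.adicCompletion K)) (algebraMap K (v.adicCompletion K) t) :=
    (IsScalarTower.algebraMap_apply (v.adicCompletion K) E (AlgebraicClosure (v.adicCompletion K)) _).symm
  rw [h1, h2, AlgHom.commutes, ← IsScalarTower.algebraMap_apply]

/-- **A `v`-integral element of `K` lies in the reading ring**: if `t ∈ K` has `|t|_v ≤ 1` then `t ∈ 𝒪_{F,(𝔓)}`.
[cite: SerreLocalFields1979, Ch. II §2 Prop. 3] [cite: deShalit1987, II §4.2 (p. 56)] -/
theorem algebraMap_mem_readingRing_of_mem_integer {t : K} (ht : algebraMap K (v.adicCompletion K) t ∈ 𝒪[v.adicCompletion K]) :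
    algebraMap K (rayClassField K 𝔪) t ∈ readingRing E hE := by
  rw [mem_readingRing_iff_mem_unitBall, readingFieldHom_algebraMap]
  have h := (algebraMap 𝒪[v.adicCompletion K] (unitBall E) ⟨_, ht⟩).2
  rwa [algebraMap_integer_apply] at h

/-- ★ **Lifting a series**: a power series over `K` whose image in `K_v⟦X⟧` has `𝒪_v`-coefficients lifts to the reading ring — there is
`T_R ∈ (readingRing E hE)⟦X⟧` mapping to `T` in `K(𝔪)⟦X⟧` (unique, the coercion being injective).
[cite: deShalit1987, II §4.9 (p. 62: «This allows us to move from the complex domain to the p-adics»)] -/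
theorem exists_powerSeries_readingRing_of_forall_mem_integer (T : PowerSeries K)
    (hT : ∀ k, algebraMap K (v.adicCompletion K) (coeff k T) ∈ 𝒪[v.adicCompletion K]) :
    ∃ T_R : PowerSeries (readingRing E hE),
      PowerSeries.map (readingRing E hE).subtype T_R = PowerSeries.map (algebraMap K (rayClassField K 𝔪)) T := by
  refine ⟨PowerSeries.mk fun k ↦ ⟨algebraMap K (rayClassField K 𝔪) (coeff k T), algebraMap_mem_readingRing_of_mem_integer E hE (hT k)⟩,
    PowerSeries.ext fun k ↦ ?_⟩
  rw [coeff_map, coeff_map, coeff_mk, Subring.coe_subtype]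

/-- The constant term of a lift vanishes iff that of the series does. [cite: deShalit1987, II §4.9] -/
theorem constantCoeff_eq_zero_of_map_subtype_eq {T_R : PowerSeries (readingRing E hE)} {T : PowerSeries K}
    (h : PowerSeries.map (readingRing E hE).subtype T_R = PowerSeries.map (algebraMap K (rayClassField K 𝔪)) T)
    (h0 : constantCoeff T = 0) : constantCoeff T_R = 0 := by
  have hk := congrArg (coeff 0) h
  rw [coeff_map, coeff_map, coeff_zero_eq_constantCoeff_apply, coeff_zero_eq_constantCoeff_apply, h0, map_zero, Subring.coe_subtype] at hk
  exact_mod_cast hk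

/-- **The `ψ_𝔓`-reading of a lift is the `𝒪_v`-series read in `𝒪_E`**: if `T_R ↦ T` in `K(𝔪)⟦X⟧` and `T_v ∈ 𝒪_v⟦X⟧` has image `T` in `K_v⟦X⟧`,
then `T_R^{ψ_𝔓} = T_v^{𝒪_v → 𝒪_E}`. [cite: deShalit1987, II §4.9 (ii)] -/
theorem map_readingHom_eq_of_map_subtype_eq {T_R : PowerSeries (readingRing E hE)} {T : PowerSeries K}
    (h : PowerSeries.map (readingRing E hE).subtype T_R = PowerSeries.map (algebraMap K (rayClassField K 𝔪)) T)
    {T_v : PowerSeries 𝒪[v.adicCompletion K]}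
    (hv : PowerSeries.map (algebraMap 𝒪[v.adicCompletion K] (v.adicCompletion K)) T_v = PowerSeries.map (algebraMap K (v.adicCompletion K)) T) :
    PowerSeries.map (readingHom E hE) T_R = PowerSeries.map (algebraMap 𝒪[v.adicCompletion K] (unitBall E)) T_v := by
  refine PowerSeries.ext fun k ↦ ?_
  have hk := congrArg (coeff k) h
  have hvk := congrArg (coeff k) hv
  rw [coeff_map, coeff_map, Subring.coe_subtype] at hk
  rw [coeff_map, coeff_map] at hvk
  rw [coeff_map, coeff_map]
  apply Subtype.ext
  rw [coe_readingHom, hk, readingFieldHom_algebraMap, ← hvk, algebraMap_integer_apply]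
  rfl

/-- The same in the `LTCoeff` currency of the Lubin–Tate files: `T_R^{ψ_𝔓} = (T_v.map LTCoeff.of)^{algebraMap}`. [cite: deShalit1987, II §4.9 (ii)] -/
theorem map_readingHom_eq_map_LTCoeff_of_map_subtype_eq {T_R : PowerSeries (readingRing E hE)} {T : PowerSeries K}
    (h : PowerSeries.map (readingRing E hE).subtype T_R = PowerSeries.map (algebraMap K (rayClassField K 𝔪)) T)
    {T_v : PowerSeries 𝒪[v.adicCompletion K]}
    (hv : PowerSeries.map (algebraMap 𝒪[v.adicCompletion K] (v.adicCompletion K)) T_v = PowerSeries.map (algebraMap K (v.adicCompletion K)) T) :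
    PowerSeries.map (readingHom E hE) T_R =
      PowerSeries.map (algebraMap (LTCoeff (v.adicCompletion K)) (unitBall E))
        (PowerSeries.map (LTCoeff.of (v.adicCompletion K)).toRingHom T_v) := by
  rw [map_readingHom_eq_of_map_subtype_eq E hE h hv, ← RingHom.comp_apply (PowerSeries.map _) (PowerSeries.map _),
    ← PowerSeries.map_comp]
  rfl

/-- **Any other reading of a lift**: for a ring map `g : K(𝔪) → S`, `T_R^{g ∘ coe} = T^{g ∘ (K → K(𝔪))}`. [cite: deShalit1987, II §4.9] -/
theorem map_comp_subtype_eq_of_map_subtype_eq {T_R : PowerSeries (readingRing E hE)} {T : PowerSeries K}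
    (h : PowerSeries.map (readingRing E hE).subtype T_R = PowerSeries.map (algebraMap K (rayClassField K 𝔪)) T)
    {S : Type*} [CommRing S] (g : rayClassField K 𝔪 →+* S) :
    PowerSeries.map (g.comp (readingRing E hE).subtype) T_R = PowerSeries.map (g.comp (algebraMap K (rayClassField K 𝔪))) T := by
  rw [PowerSeries.map_comp, RingHom.comp_apply, h, PowerSeries.map_comp, RingHom.comp_apply]

end Lift

/-! ## §2. The series `exp_W(π·log_W)` of the integer model `[1, −1, 0, −2, −1]` -/

section Series

/-- **`exp_W(π·log_W)` commutes with ring maps** for the integer model: `(exp_{W_A}(π log_{W_A}))^f = exp_{W_B}(f(π) log_{W_B})`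
(`map_formalExp`, `map_formalLog`, `cm7Model_map`). [cite: SilvermanAEC2009, IV.4–IV.5] -/
theorem map_cm7FormalMulBy {A B : Type*} [CommRing A] [CommRing B] [Algebra ℚ A] [Algebra ℚ B] (f : A →+* B) (π : A) :
    PowerSeries.map f (PowerSeries.subst (C π * (⟨1, -1, 0, -2, -1⟩ : WeierstrassCurve A).formalLog)
        (⟨1, -1, 0, -2, -1⟩ : WeierstrassCurve A).formalExp) =
      PowerSeries.subst (C (f π) * (⟨1, -1, 0, -2, -1⟩ : WeierstrassCurve B).formalLog)
        (⟨1, -1, 0, -2, -1⟩ : WeierstrassCurve B).formalExp := by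
  have h0 : PowerSeries.constantCoeff (C π * (⟨1, -1, 0, -2, -1⟩ : WeierstrassCurve A).formalLog) = 0 := by
    rw [map_mul, WeierstrassCurve.constantCoeff_formalLog, mul_zero]
  have ha : HasSubst (C π * (⟨1, -1, 0, -2, -1⟩ : WeierstrassCurve A).formalLog) := HasSubst.of_constantCoeff_zero' h0
  have h := PowerSeries.map_subst ha (h := f) (⟨1, -1, 0, -2, -1⟩ : WeierstrassCurve A).formalExp
  have h' : PowerSeries.map f (PowerSeries.subst (C π * (⟨1, -1, 0, -2, -1⟩ : WeierstrassCurve A).formalLog)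
      (⟨1, -1, 0, -2, -1⟩ : WeierstrassCurve A).formalExp) =
      PowerSeries.subst (PowerSeries.map f (C π * (⟨1, -1, 0, -2, -1⟩ : WeierstrassCurve A).formalLog))
        (PowerSeries.map f (⟨1, -1, 0, -2, -1⟩ : WeierstrassCurve A).formalExp) := h
  rw [h', WeierstrassCurve.map_formalExp, map_mul, map_C, WeierstrassCurve.map_formalLog, cm7Model_map]

/-- The constant term of `exp_W(π·log_W)` vanishes. [cite: SilvermanAEC2009, IV.5] -/
theorem constantCoeff_cm7FormalMulBy {A : Type*} [CommRing A] [Algebra ℚ A] (π : A) :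
    constantCoeff (PowerSeries.subst (C π * (⟨1, -1, 0, -2, -1⟩ : WeierstrassCurve A).formalLog)
      (⟨1, -1, 0, -2, -1⟩ : WeierstrassCurve A).formalExp) = 0 :=
  constantCoeff_subst_eq_zero (by
      change PowerSeries.constantCoeff (C π * (⟨1, -1, 0, -2, -1⟩ : WeierstrassCurve A).formalLog) = 0
      rw [map_mul, WeierstrassCurve.constantCoeff_formalLog, mul_zero]) _
    (WeierstrassCurve.constantCoeff_formalExp _)

variable (K : Type) [Field K] [NumberField K] (v : HeightOneSpectrum (𝓞 K)) [v.asIdeal.LiesOver (ratPlace 2).asIdeal]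
  (he : v.asIdeal.ramificationIdx (𝓞 ℚ) = 1) (hf : v.asIdeal.inertiaDeg (𝓞 ℚ) = 1)

/-- ★ **Over `K_v`: `exp_W(π·log_W) = P` read through `ℚ₂ ≃ K_v`** — for the `ℤ₂`-datum `P ↦ exp_V(c·log_V)` of the integer model
(`cm7Padic_exists_formalGroupLaw_eq_ltF`) and `π ∈ K_v` with `eK(π) = c` (`eK = padicEquivOfDegreeOne`), the series `[π]_Ê` of the model
over `K_v` is `P^{eK⁻¹ ∘ (ℤ₂ ⊂ ℚ₂)}`. [cite: deShalit1987, II §1.10 Lemma (p. 39)] [cite: FrohlichTaylor1990, Ch. III §1 (1.14)(a)] -/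
theorem cm7FormalMulBy_eq_map_of_padicDatum {c : ℤ_[2]} {P : PowerSeries ℤ_[2]}
    (hP : P.map PadicInt.Coe.ringHom =
      ((⟨1, -1, 0, -2, -1⟩ : WeierstrassCurve ℤ_[2]).map PadicInt.Coe.ringHom).formalExp.subst
        (C (c : ℚ_[2]) * ((⟨1, -1, 0, -2, -1⟩ : WeierstrassCurve ℤ_[2]).map PadicInt.Coe.ringHom).formalLog))
    {π : v.adicCompletion K} (hc : padicEquivOfDegreeOne K 2 v he hf π = c) :
    PowerSeries.subst (C π * (⟨1, -1, 0, -2, -1⟩ : WeierstrassCurve (v.adicCompletion K)).formalLog)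
        (⟨1, -1, 0, -2, -1⟩ : WeierstrassCurve (v.adicCompletion K)).formalExp =
      P.map (((padicEquivOfDegreeOne K 2 v he hf).symm.toRingHom).comp (PadicInt.Coe.ringHom (p := 2))) := by
  have hπ : (padicEquivOfDegreeOne K 2 v he hf).symm.toRingHom (c : ℚ_[2]) = π := by
    rw [← hc]; exact (padicEquivOfDegreeOne K 2 v he hf).symm_apply_apply π
  have h := congrArg (PowerSeries.map (padicEquivOfDegreeOne K 2 v he hf).symm.toRingHom) hP
  rw [← RingHom.comp_apply (PowerSeries.map _) (PowerSeries.map _), ← PowerSeries.map_comp, cm7Model_map] at h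
  rw [h, map_cm7FormalMulBy, hπ]

/-- **`exp_W(π·log_W) ∈ 𝒪_v⟦X⟧`** in the form the lift needs: it is `(P.map e⁻¹)` read in `K_v` (`e : 𝒪[K_v] ≃ ℤ₂` the integer
identification). [cite: deShalit1987, II §1.10 Lemma (p. 39)] [cite: FrohlichTaylor1990, Ch. III §1 (1.14)(a)] -/
theorem cm7FormalMulBy_eq_map_map_of_padicDatum {c : ℤ_[2]} {P : PowerSeries ℤ_[2]}
    (hP : P.map PadicInt.Coe.ringHom =
      ((⟨1, -1, 0, -2, -1⟩ : WeierstrassCurve ℤ_[2]).map PadicInt.Coe.ringHom).formalExp.subst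
        (C (c : ℚ_[2]) * ((⟨1, -1, 0, -2, -1⟩ : WeierstrassCurve ℤ_[2]).map PadicInt.Coe.ringHom).formalLog))
    {π : v.adicCompletion K} (hc : padicEquivOfDegreeOne K 2 v he hf π = c) :
    PowerSeries.subst (C π * (⟨1, -1, 0, -2, -1⟩ : WeierstrassCurve (v.adicCompletion K)).formalLog)
        (⟨1, -1, 0, -2, -1⟩ : WeierstrassCurve (v.adicCompletion K)).formalExp =
      PowerSeries.map (algebraMap 𝒪[v.adicCompletion K] (v.adicCompletion K))
        (P.map ((integerEquivAdicCompletionIntegers v).trans (padicIntEquivOfDegreeOne K 2 v he hf)).symm.toRingHom) := by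
  rw [cm7FormalMulBy_eq_map_of_padicDatum K v he hf hP hc, padicEquivOfDegreeOne_symm_comp_coe K 2 v he hf, PowerSeries.map_comp,
    RingHom.comp_apply]

/-- Hence every coefficient of `exp_W(π·log_W)` over `K_v` is `v`-integral. [cite: deShalit1987, II §1.10 Lemma (p. 39)] -/
theorem coeff_cm7FormalMulBy_mem_integer {c : ℤ_[2]} {P : PowerSeries ℤ_[2]}
    (hP : P.map PadicInt.Coe.ringHom =
      ((⟨1, -1, 0, -2, -1⟩ : WeierstrassCurve ℤ_[2]).map PadicInt.Coe.ringHom).formalExp.subst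
        (C (c : ℚ_[2]) * ((⟨1, -1, 0, -2, -1⟩ : WeierstrassCurve ℤ_[2]).map PadicInt.Coe.ringHom).formalLog))
    {π : v.adicCompletion K} (hc : padicEquivOfDegreeOne K 2 v he hf π = c) (k : ℕ) :
    coeff k (PowerSeries.subst (C π * (⟨1, -1, 0, -2, -1⟩ : WeierstrassCurve (v.adicCompletion K)).formalLog)
        (⟨1, -1, 0, -2, -1⟩ : WeierstrassCurve (v.adicCompletion K)).formalExp) ∈ 𝒪[v.adicCompletion K] := by
  rw [cm7FormalMulBy_eq_map_map_of_padicDatum K v he hf hP hc, coeff_map]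
  exact SetLike.coe_mem _

end Series

/-! ## §3. The series over the reading ring, with both readings -/

section Reading

variable {K : Type} [Field K] [NumberField K] {v : HeightOneSpectrum (𝓞 K)} [v.asIdeal.LiesOver (ratPlace 2).asIdeal]
  (he : v.asIdeal.ramificationIdx (𝓞 ℚ) = 1) (hf : v.asIdeal.inertiaDeg (𝓞 ℚ) = 1) {𝔪 : Ideal (𝓞 K)}
  (E : IntermediateField (v.adicCompletion K) (AlgebraicClosure (v.adicCompletion K)))
  [FiniteDimensional (v.adicCompletion K) E]
  (hE : ∀ y : AlgebraicClosure K, y ∈ rayClassField K 𝔪 → absClosureEmbedding K (v.adicCompletion K) y ∈ E)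

/-- ★★ **Brick B8a — the series `T = [π₀]_Ê` over the reading ring with both readings.**  For `π₀ ∈ K` with `eK(π₀) = c` and the
`ℤ₂`-datum `P ↦ exp_V(c·log_V)` of `[1,−1,0,−2,−1]`: there is `T_R ∈ (readingRing E hE)⟦X⟧` with
(0) `T_R(0) = 0`; (i) `T_R ↦ exp_{W_K}(π₀·log_{W_K})` in `K(𝔪)⟦X⟧`; (ii) `T_R^{ψ_𝔓} = P′ := P.map (LTCoeff.of ∘ e⁻¹)` read in `𝒪_E` (the
Lubin–Tate series `[π₀]_f = f` of the lane); (iii) for every ring map `g : K(𝔪) → S` into a `ℚ`-algebra (`ι̂ ∘ coe`, `ι̂ ∘ τ⁻¹ ∘ coe`, …),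
`T_R^{g ∘ coe} = exp_{W_S}(g(π₀)·log_{W_S})` — the `T` of `CMFormalActionTaylorOfTransformationProofs` at `α = g(π₀)`.
[cite: deShalit1987, II §1.10 Lemma (p. 39), II §4.9 (ii) (p. 62–63)] [cite: SilvermanAEC2009, IV.4–IV.5] -/
theorem exists_readingSeries_cm7FormalMulBy {c : ℤ_[2]} {P : PowerSeries ℤ_[2]}
    (hP : P.map PadicInt.Coe.ringHom =
      ((⟨1, -1, 0, -2, -1⟩ : WeierstrassCurve ℤ_[2]).map PadicInt.Coe.ringHom).formalExp.subst
        (C (c : ℚ_[2]) * ((⟨1, -1, 0, -2, -1⟩ : WeierstrassCurve ℤ_[2]).map PadicInt.Coe.ringHom).formalLog))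
    (π₀ : K) (hc : padicEquivOfDegreeOne K 2 v he hf (algebraMap K (v.adicCompletion K) π₀) = c) :
    ∃ T_R : PowerSeries (readingRing E hE),
      constantCoeff T_R = 0 ∧
      PowerSeries.map (readingRing E hE).subtype T_R =
        PowerSeries.map (algebraMap K (rayClassField K 𝔪))
          (PowerSeries.subst (C π₀ * (⟨1, -1, 0, -2, -1⟩ : WeierstrassCurve K).formalLog) (⟨1, -1, 0, -2, -1⟩ : WeierstrassCurve K).formalExp) ∧
      PowerSeries.map (readingHom E hE) T_R =
        PowerSeries.map (algebraMap (LTCoeff (v.adicCompletion K)) (unitBall E))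
          (P.map ((LTCoeff.of (v.adicCompletion K)).toRingHom.comp
            ((integerEquivAdicCompletionIntegers v).trans (padicIntEquivOfDegreeOne K 2 v he hf)).symm.toRingHom)) ∧
      ∀ (S : Type) [CommRing S] [Algebra ℚ S] (g : rayClassField K 𝔪 →+* S),
        PowerSeries.map (g.comp (readingRing E hE).subtype) T_R =
          PowerSeries.subst (C (g (algebraMap K (rayClassField K 𝔪) π₀)) * (⟨1, -1, 0, -2, -1⟩ : WeierstrassCurve S).formalLog)
            (⟨1, -1, 0, -2, -1⟩ : WeierstrassCurve S).formalExp := by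
  set T : PowerSeries K := PowerSeries.subst (C π₀ * (⟨1, -1, 0, -2, -1⟩ : WeierstrassCurve K).formalLog)
    (⟨1, -1, 0, -2, -1⟩ : WeierstrassCurve K).formalExp with hTdef
  -- the image in `K_v⟦X⟧` is `exp(π·log)` over `K_v`, `π = π₀`, with `𝒪_v`-coefficients
  have hTv : PowerSeries.map (algebraMap K (v.adicCompletion K)) T =
      PowerSeries.subst (C (algebraMap K (v.adicCompletion K) π₀) * (⟨1, -1, 0, -2, -1⟩ : WeierstrassCurve (v.adicCompletion K)).formalLog)
        (⟨1, -1, 0, -2, -1⟩ : WeierstrassCurve (v.adicCompletion K)).formalExp :=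
    map_cm7FormalMulBy _ π₀
  have hint : ∀ k, algebraMap K (v.adicCompletion K) (coeff k T) ∈ 𝒪[v.adicCompletion K] := fun k ↦ by
    rw [← coeff_map, hTv]; exact coeff_cm7FormalMulBy_mem_integer K v he hf hP hc k
  obtain ⟨T_R, hR⟩ := exists_powerSeries_readingRing_of_forall_mem_integer E hE T hint
  have hv : PowerSeries.map (algebraMap 𝒪[v.adicCompletion K] (v.adicCompletion K))
      (P.map ((integerEquivAdicCompletionIntegers v).trans (padicIntEquivOfDegreeOne K 2 v he hf)).symm.toRingHom) =
      PowerSeries.map (algebraMap K (v.adicCompletion K)) T := by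
    rw [hTv, cm7FormalMulBy_eq_map_map_of_padicDatum K v he hf hP hc]
  refine ⟨T_R, constantCoeff_eq_zero_of_map_subtype_eq E hE hR (constantCoeff_cm7FormalMulBy π₀), hR, ?_, fun S _ _ g ↦ ?_⟩
  · rw [map_readingHom_eq_map_LTCoeff_of_map_subtype_eq E hE hR hv, PowerSeries.map_comp, RingHom.comp_apply]
  · rw [map_comp_subtype_eq_of_map_subtype_eq E hE hR g, hTdef, map_cm7FormalMulBy, RingHom.comp_apply]

end Reading


/-! ## §4 (appended). Lifting `v`-integral POLYNOMIALS of `K` into the reading ring (the certificate polynomials `P̂, Q̂` of brick B8b) -/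

section PolyLift

variable {K : Type} [Field K] [NumberField K] {v : HeightOneSpectrum (𝓞 K)} {𝔪 : Ideal (𝓞 K)}
  (E : IntermediateField (v.adicCompletion K) (AlgebraicClosure (v.adicCompletion K)))
  [FiniteDimensional (v.adicCompletion K) E]
  (hE : ∀ y : AlgebraicClosure K, y ∈ rayClassField K 𝔪 → absClosureEmbedding K (v.adicCompletion K) y ∈ E)

/-- ★ **Lifting a polynomial**: a polynomial over `K` with `v`-integral coefficients lifts to `(readingRing E hE)[X]` — there is
`P_R` mapping to `P` in `K(𝔪)[X]` (the lifts `P̂_R, Q̂_R` of the `2^N`-cleared certificate polynomials of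
`CMFormalActionReadingIdentities.cmX_identity_of_reading`). [cite: deShalit1987, II §4.2 (p. 56: the model over the localization at `𝔭`)] -/
theorem exists_polynomial_readingRing_of_forall_mem_integer (P : Polynomial K)
    (hP : ∀ k, algebraMap K (v.adicCompletion K) (P.coeff k) ∈ 𝒪[v.adicCompletion K]) :
    ∃ P_R : Polynomial (readingRing E hE),
      P_R.map (readingRing E hE).subtype = P.map (algebraMap K (rayClassField K 𝔪)) := by
  have h : P.map (algebraMap K (rayClassField K 𝔪)) ∈ Polynomial.lifts (readingRing E hE).subtype := by
    rw [Polynomial.lifts_iff_coeff_lifts]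
    intro k
    rw [Polynomial.coeff_map]
    exact ⟨⟨_, algebraMap_mem_readingRing_of_mem_integer E hE (hP k)⟩, rfl⟩
  obtain ⟨P_R, hPR⟩ := (Polynomial.mem_lifts _).mp h
  exact ⟨P_R, hPR⟩

/-- **Any reading of a lifted polynomial**: for a ring map `g : K(𝔪) → S`, `P_R^{g ∘ coe} = P^{g ∘ (K → K(𝔪))}`. [cite: deShalit1987, II §4.9] -/
theorem polynomial_map_comp_subtype_eq_of_map_subtype_eq {P_R : Polynomial (readingRing E hE)} {P : Polynomial K}
    (h : P_R.map (readingRing E hE).subtype = P.map (algebraMap K (rayClassField K 𝔪)))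
    {S : Type*} [CommRing S] (g : rayClassField K 𝔪 →+* S) :
    P_R.map (g.comp (readingRing E hE).subtype) = P.map (g.comp (algebraMap K (rayClassField K 𝔪))) := by
  rw [← Polynomial.map_map, h, Polynomial.map_map]

/-- **The `ψ_𝔓`-reading of a lifted polynomial** is the `𝒪_v`-polynomial read in `𝒪_E`. [cite: deShalit1987, II §4.9 (ii)] -/
theorem polynomial_map_readingHom_eq_of_map_subtype_eq {P_R : Polynomial (readingRing E hE)} {P : Polynomial K}
    (h : P_R.map (readingRing E hE).subtype = P.map (algebraMap K (rayClassField K 𝔪)))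
    {P_v : Polynomial 𝒪[v.adicCompletion K]}
    (hv : P_v.map (algebraMap 𝒪[v.adicCompletion K] (v.adicCompletion K)) = P.map (algebraMap K (v.adicCompletion K))) :
    P_R.map (readingHom E hE) = P_v.map (algebraMap 𝒪[v.adicCompletion K] (unitBall E)) := by
  refine Polynomial.ext fun k ↦ ?_
  have hk := congrArg (fun p ↦ Polynomial.coeff p k) h
  have hvk := congrArg (fun p ↦ Polynomial.coeff p k) hv
  simp only [Polynomial.coeff_map, Subring.coe_subtype] at hk hvk
  rw [Polynomial.coeff_map, Polynomial.coeff_map]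
  apply Subtype.ext
  rw [coe_readingHom, hk, readingFieldHom_algebraMap, ← hvk, algebraMap_integer_apply]
  rfl

end PolyLift

end DeShalit1987

end Literature.NumberTheory.EllipticCurves

end
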